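import Summits.QuantumFields.YangMills.Theorems.BalabanUVNodesK0RecordFormatNamesLocD

/-!
# K0⁷ — THE RECORD-SIDE FORMAT NAMES, EDITION 17 = the WHOLE-TORUS chart-unit localized response data (★ PTB-1 g4's INTENT-g4-1 §2, by name):
# `recordResponse9DataLocUnivξ ∕ recordResponse9DataFromLocUnivξ` and the receipt `Response9DAtLocUnivξ`

Cell `ym-nodeO-ideate` ∕ `ym-balaban-port`, DEFINER seat `ym-nodeO-def-1` (gen 35), on ★ porter PT-B `ymgap-nodeO-port-PTB-1` g4's name-by-name ask (nodeO STATUS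
2026-08-31T05:33:28Z, INTENT-g4-1 §2: «the full `Response9D`-shape for `Gk n := recordGkLocWξ … (K₀+n) Finset.univ a` … inline `Response9Data` term unless DEF-1 prefers a name
`recordResponse9DataFromLocUniv`»).  DEF-1's word: a NAME, with ed.16c's chart-unit suffix `ξ`.  `--kind definition --supports stmt-QuantumFields-20541 --as helper`; count-neutral.
[I] = [Balaban1987RG1], [15] = [Balaban1985Variational], [B6] = [Balaban1984PropagatorsII].

CONTEXT (director-ym №508∕№509∕№512; ◆ CRIT-1 g35 R-CRIT1-g35-2).  27931 `PortPieceLocalityU8` is CLOSED · IMPLICATION-ONLY: its displayed tokens Tok-182 and ‴ (one-volume decay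
of the ROOTED-gauge response `recordHr`) are false-shaped given HypAn (W-wrap: the record's gauge normal form combs with torus-wrapping legs).  The consumable objects are the
SELECTOR-FREE ones: the [B6] (2.35) window∕torus responses `windowResp(ξ) W` and their coordinates `recordGkLocWξ W` (ed.16∕16c), with the window transport ∕ sandwich chain.
★ PTB-1 g4 re-derives the two-volume row (R4ᴰ)′ and the rows (R1ᴰ)(R3)(R5) for the WHOLE-TORUS chart-unit data `Gk n := recordGkLocWξ F θ k (K₀+n) Finset.univ a` from the (190)
token at `Hr := recordHrLocξ … Finset.univ` and Tok-cmpU-cap; THIS FILE names that data in typer-1's `B12FormatPlus.Response9Data` format, byte-parallel to ed.16c's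
`recordResponse9DataFromLocAtξ` (LocC :136), ed.16's `recordResponse9DataLoc` (NamesLoc :169) and ed.14's receipt `Response9DAtL` (NamesL :162) — only the `Gk` slot differs.

WHAT THIS FILE IS (definitions only; statement-form; NEW names, §1–§24 untouched — append-only rule):
* §24j `recordResponse9DataLocUnivξ F θ a Mc k` — unshifted: `Gk := fun K => recordGkLocWξ F θ k K Finset.univ a`, every other field as in `recordResponse9DataLoc ∕ J ∕ L`.
* §24j ★ `recordResponse9DataFromLocUnivξ F θ a Mc k K₀` — from the base volume `K₀` (member `n` = volume `K₀ + n`): `Gk := fun n => recordGkLocWξ F θ k (K₀ + n) Finset.univ a`,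
  every other field = the CENTRED two-volume layer fields of `…FromJ ∕ …FromL ∕ …FromLocAtξ` verbatim; face `recordResponse9DataFromLocUnivξ_eq_update` (`rfl`): it IS
  `{ recordResponse9DataFromL … with Gk := … }`, the structure-update spelling ★ PTB-1 g4's `…PortU8Response9LocUniv` uses.
* §24j receipt `Response9DAtLocUnivξ F θ a Mc k K₀ α₂ C₉ δ₀` — typer-1's plain `B12FormatPlus.Response9D` for that data in the gauge norm of the two-block (4.4) domain, CENTRED
  layer, radius `recordRNat`, base volume `K₀` (the shape PTB-1's §2 targets).  Prop-valued; asserts nothing.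

HONEST FRAMING.  Definitions only; NOTHING of Bałaban is asserted, ported or discharged; the rows for this data are porter theorems from displayed (190)∕comparison tokens on
selector-free objects (R-CRIT1-g35-2's S-wrap exemption), not asserted here; 27931 CLOSED·implication-only (№512); 27930∕26648 OPEN; K0ᴬ∕K1ᴬ∕K3ᴬ OPEN; NODE O not inhabited
(0∕1); COUNT 8∕28 · K 1∕4 UNMOVED; finite `𝕋⁴_{L^K}` at fixed ε — NOT continuum ∕ ℝ⁴ ∕ OS; **the Yang–Mills mass gap (Clay) is NOT proved by any of this.**  No `sorry`,
`instance`, `notation`; standard axioms.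
-/

noncomputable section

open scoped BigOperators Matrix.Norms.L2Operator

namespace Summit.QuantumFields.YangMills.Theorems.K0RecordFormatNames

open Literature.MathematicalPhysics.QuantumFieldTheory.Balaban1983to89
open Literature.MathematicalPhysics.QuantumFieldTheory.Balaban1983to89.Node00
open Literature.MathematicalPhysics.QuantumFieldTheory.Balaban1983to89.T4Continuum (T4Family)

variable (F : T4Family)

/-! ## §24j  The whole-torus chart-unit localized response data and its receipt -/

section Theta

variable (θ : Stage13Params F 2)

/-- **The WHOLE-TORUS chart-unit localized response data** (unshifted): typer-1's `Response9Data` at the record with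
`Gk := fun K => recordGkLocWξ F θ k K Finset.univ a` (𝐔-block = 𝔰𝔩₂-coordinates of `recordHrLocξ … Finset.univ a l` = `ξ·H e_l·ρ₈(bV a)`, [B6] (2.35) at the whole-torus
family; 𝐉-block = `recordJLocξ … Finset.univ`), every other field as in `recordResponse9DataLoc ∕ …J ∕ …L`.  Selector-free.
[cite: Balaban1985Variational, Prop. 9 p.309, (190) p.308; Balaban1987RG1, (4.35) p.290; Balaban1984PropagatorsII, (2.35) p.228] -/
def recordResponse9DataLocUnivξ (a : θ.ιβ) (Mc k : ℕ) :
    B12FormatPlus.Response9Data (recordDomSys F Mc k) (recordBondCount F) (recordChartDimJ F) 4 where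
  Cc := recordCc F Mc k
  Λ := RespLabel F k
  G := recordSiteGeom F Mc k
  ρ := recordRho F k
  e := recordE F k
  cX := recordCXJ F Mc k
  siteOf := fun K => recordSiteOfJ F k K
  Gk := fun K => recordGkLocWξ F θ k K Finset.univ a
  wrap := recordWrapCtr F Mc k
  emb := recordDomEmbCtr F Mc k
  jX := fun K _ => recordJXJ F K
  πc := fun K _ => recordCoordProjCtr F K

/-- ★ **The WHOLE-TORUS chart-unit localized response data from the base volume `K₀`** (member `n` = volume `K₀ + n`):
`Gk := fun n => recordGkLocWξ F θ k (K₀ + n) Finset.univ a`, every other field = the CENTRED two-volume layer fields of `recordResponse9DataFromJ ∕ …FromL ∕ …FromLocAtξ`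
verbatim — the data ★ PTB-1's (R4ᴰ)′ ∕ (R1ᴰ)(R3)(R5) rows for selector-free objects are stated over.  [cite: Balaban1985Variational, Prop. 9 p.309, (190) p.308; Balaban1987RG1, (1.21) p.264, (4.35) p.290; Balaban1984PropagatorsII, (2.35) p.228] -/
def recordResponse9DataFromLocUnivξ (a : θ.ιβ) (Mc k K₀ : ℕ) :
    B12FormatPlus.Response9Data (fun n => recordDomSys F Mc k (K₀ + n)) (fun n => recordBondCount F (K₀ + n)) (fun n => recordChartDimJ F (K₀ + n)) 4 where
  Cc := fun n => recordCc F Mc k (K₀ + n)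
  Λ := fun n => RespLabel F k (K₀ + n)
  G := fun n => recordSiteGeom F Mc k (K₀ + n)
  ρ := fun n => recordRho F k (K₀ + n)
  e := fun n => recordE F k (K₀ + n)
  cX := fun n => recordCXJ F Mc k (K₀ + n)
  siteOf := fun n => recordSiteOfJ F k (K₀ + n)
  Gk := fun n => recordGkLocWξ F θ k (K₀ + n) Finset.univ a
  wrap := fun n => recordWrapCtr F Mc k (K₀ + n)
  emb := fun n => recordDomEmbCtr F Mc k (K₀ + n)
  jX := fun n _ => recordJXJ F (K₀ + n)
  πc := fun n _ => recordCoordProjCtr F (K₀ + n)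

/-- FACE (by `rfl`): the whole-torus localized data IS ed.14's `recordResponse9DataFromL` with the `Gk` slot UPDATED — the structure-update term ★ PTB-1 g4's
`…PortU8Response9LocUniv` states its rows over (`{ recordResponse9DataFromL … with Gk := fun n => recordGkLocWξ … (K₀ + n) Finset.univ a }`), so either spelling serves.
[cite: Balaban1985Variational, Prop. 9 p.309; Balaban1987RG1, (4.35) p.290] -/
theorem recordResponse9DataFromLocUnivξ_eq_update (a : θ.ιβ) (Mc k K₀ : ℕ) :
    recordResponse9DataFromLocUnivξ F θ a Mc k K₀ =
      { recordResponse9DataFromL F θ a Mc k K₀ with Gk := fun n => recordGkLocWξ F θ k (K₀ + n) Finset.univ a } := rfl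

/-- **RECEIPT `Response9DAtLocUnivξ F θ a Mc k K₀ α₂ C₉ δ₀`**: typer-1's plain `B12FormatPlus.Response9D` ((R0) constants, (R1ᴰ) one-volume decay, (R3) unwrap compatibility,
(R4ᴰ) two-volume comparison, (R5) chart intertwining) for the WHOLE-TORUS chart-unit localized data from the base volume `K₀`, in the gauge norm of the two-block (4.4) domain,
CENTRED layer, radius `recordRNat` — the shape of ed.14's `Response9DAtL` with the selector-free data.  Prop-valued; DISPLAYED, asserts nothing (its rows are porter theorems
from the (190) token at `recordHrLocξ … Finset.univ` and Tok-cmpU-cap). [cite: Balaban1985Variational, Prop. 9 p.309, (190) p.308; Balaban1987RG1, (4.4) p.281, (1.21) p.264, (4.35) p.290] -/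
def Response9DAtLocUnivξ (a : θ.ιβ) (Mc k K₀ : ℕ) (α₂ C₉ δ₀ : ℝ) : Prop :=
  B12FormatPlus.Response9D (recordResponse9DataFromLocUnivξ F θ a Mc k K₀) (fun n => recordChartJ F Mc k (K₀ + n)) (fun n => recordRNat F Mc k (K₀ + n))
    (fun n X => recordDom44J F Mc k (K₀ + n) X α₂) C₉ δ₀

end Theta

end Summit.QuantumFields.YangMills.Theorems.K0RecordFormatNames

end
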